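import Mathlib
import Summits.Ventures.DiscreteObjects.Mahler.CensusRowsKernel
import Summits.Ventures.DiscreteObjects.Mahler.CensusRows20Kernel
import Summits.Ventures.DiscreteObjects.Mahler.CensusRows22Kernel
import Summits.Ventures.DiscreteObjects.Mahler.CensusRows24Kernel
import Summits.Ventures.DiscreteObjects.Mahler.CensusRows26Kernel
import Summits.Ventures.DiscreteObjects.Mahler.CensusDeg20LehmerLifts
import Summits.Ventures.DiscreteObjects.Mahler.Height1Rows46Kernel
import Summits.Ventures.DiscreteObjects.Mahler.Height1Rows48Kernel

/-!
# All listed census polynomials in one kernel statement: bounds, and Lehmer's measure is the minimum (venture `DiscreteObjects`, target L)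

Cell `pub-namedobj`, seat `pub-namedobj-mahler` (gen 11). Framing: lottery ticket; floor = certified
bounds/negative ranges.

Assembly (no new computation) of the per-row kernel statements `coresDeg{10,…,26}_measure_bounds / _gap`
(`CensusRowsKernel`, `CensusRows20/22/24/26Kernel`), `c20_36/37_measure_eq_lehmer` (`CensusDeg20LehmerLifts`) and
`h1Deg46/48_measure_bounds / _above_lehmer` (`Height1Rows46/48Kernel`) into statements about the WHOLE lists:

* `census_listed_length`, `height1_listed_length` — the lists have `277` and `157` entries;
* `census_listed_measure_bounds`, `height1_listed_measure_bounds` — every listed polynomial has `1 < M < 13/10`;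
* `lehmer_le_census_listed` — `M(ℓ) ≤ M(P)` for every one of the 277 listed census cores of degree `10–26`
  (equality at `c10_01 = ℓ(-x)`, `c20_36 = ℓ(-x²)`, `c20_37 = ℓ(x²)`);
* `lehmer_gap_census_listed` — every other listed census core has `M(P) > M(ℓ) + 1/100`;
* `lehmer_gap_height1_listed` — every listed height-1 polynomial of degree 46/48 has `M(P) > M(ℓ) + 1/20`.

These are statements about the LISTED polynomials only (the cell's census lists `coresDegD`, `h1Deg46List`,
`h1Deg48List`); completeness of the lists is the cell's two-engine computation and is not claimed here.
-/

namespace Summit.Ventures.DiscreteObjects.Mahler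

open Polynomial

/-- The census lists of degrees `10–26` have `277` entries in total. -/
theorem census_listed_length :
    (coresDeg10 ++ coresDeg12 ++ coresDeg14 ++ coresDeg16 ++ coresDeg18 ++ coresDeg20 ++ coresDeg22 ++ coresDeg24 ++
        coresDeg26).length = 277 := by
  simp only [coresDeg10, coresDeg12, coresDeg14, coresDeg16, coresDeg18, coresDeg20, coresDeg22, coresDeg24, coresDeg26,
    List.length_append, List.length_cons, List.length_nil]

/-- The height-1 lists of degrees `46` and `48` have `157` entries in total. -/
theorem height1_listed_length : (h1Deg46List ++ h1Deg48List).length = 157 := by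
  simp only [h1Deg46List, h1Deg48List, List.length_append, List.length_cons, List.length_nil]

/-- **Every listed census core of degree `10–26` has `1 < M < 13/10`** (277 kernel enclosures). -/
theorem census_listed_measure_bounds :
    ∀ l ∈ coresDeg10 ++ coresDeg12 ++ coresDeg14 ++ coresDeg16 ++ coresDeg18 ++ coresDeg20 ++ coresDeg22 ++ coresDeg24 ++
        coresDeg26, 1 < intMahlerMeasure (ofCoeffs l) ∧ intMahlerMeasure (ofCoeffs l) < 13 / 10 := by
  intro l hl
  simp only [List.mem_append] at hl
  rcases hl with (((((((h | h) | h) | h) | h) | h) | h) | h) | h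
  exacts [coresDeg10_measure_bounds l h, coresDeg12_measure_bounds l h, coresDeg14_measure_bounds l h,
    coresDeg16_measure_bounds l h, coresDeg18_measure_bounds l h, coresDeg20_measure_bounds l h,
    coresDeg22_measure_bounds l h, coresDeg24_measure_bounds l h, coresDeg26_measure_bounds l h]

/-- **Every listed height-1 polynomial of degree `46` or `48` has `1 < M < 13/10`** (157 kernel enclosures). -/
theorem height1_listed_measure_bounds :
    ∀ l ∈ h1Deg46List ++ h1Deg48List,
      1 < intMahlerMeasure (ofCoeffs l) ∧ intMahlerMeasure (ofCoeffs l) < 13 / 10 := by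
  intro l hl
  rcases List.mem_append.mp hl with h | h
  exacts [h1Deg46_measure_bounds l h, h1Deg48_measure_bounds l h]

/-- `M(ℓ) < 1.1883 − 1/100` (from the 12-digit kernel enclosure of Lehmer's measure). -/
theorem lehmer_measure_add_lt_gap :
    intMahlerMeasure lehmerPoly + 1 / 100 < (11883 / 10 ^ 4 : ℝ) := by
  have h := lehmer_measure_enclosure.2
  linarith

/-- **Lehmer's measure is the minimum over all 277 listed census cores of degree `10–26`:** `M(ℓ) ≤ M(P)`
(with equality exactly at the three listed avatars of `ℓ`: `c10_01 = ℓ(-x)`, `c20_36 = ℓ(-x²)`, `c20_37 = ℓ(x²)`). -/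
theorem lehmer_le_census_listed :
    ∀ l ∈ coresDeg10 ++ coresDeg12 ++ coresDeg14 ++ coresDeg16 ++ coresDeg18 ++ coresDeg20 ++ coresDeg22 ++ coresDeg24 ++
        coresDeg26, intMahlerMeasure lehmerPoly ≤ intMahlerMeasure (ofCoeffs l) := by
  have hL := lehmer_measure_add_lt_gap
  have gap_le18 : ∀ l ∈ coresDeg10 ++ coresDeg12 ++ coresDeg14 ++ coresDeg16 ++ coresDeg18,
      intMahlerMeasure lehmerPoly ≤ intMahlerMeasure (ofCoeffs l) := by
    intro l hl
    by_cases h01 : l = c10_01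
    · subst h01
      rw [ofCoeffs_c10_01_eq, intMahlerMeasure_comp_neg_X]
    · have := census_le18_gap l hl h01
      linarith
  intro l hl
  simp only [List.mem_append] at hl
  rcases hl with (((((((h | h) | h) | h) | h) | h) | h) | h) | h
  · exact gap_le18 l (by simp only [List.mem_append]; exact Or.inl (Or.inl (Or.inl (Or.inl h))))
  · exact gap_le18 l (by simp only [List.mem_append]; exact Or.inl (Or.inl (Or.inl (Or.inr h))))
  · exact gap_le18 l (by simp only [List.mem_append]; exact Or.inl (Or.inl (Or.inr h)))
  · exact gap_le18 l (by simp only [List.mem_append]; exact Or.inl (Or.inr h))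
  · exact gap_le18 l (by simp only [List.mem_append]; exact Or.inr h)
  · by_cases h36 : l = c20_36
    · subst h36
      exact le_of_eq c20_36_measure_eq_lehmer.symm
    by_cases h37 : l = c20_37
    · subst h37
      exact le_of_eq c20_37_measure_eq_lehmer.symm
    have := coresDeg20_gap l h h36 h37
    linarith
  · have := coresDeg22_gap l h
    linarith
  · have := coresDeg24_gap l h
    linarith
  · have := coresDeg26_gap l h
    linarith

/-- **Isolation of Lehmer's measure among the listed census cores:** every listed census core of degree `10–26`
other than the three avatars of `ℓ` has `M(P) > M(ℓ) + 1/100` (in fact `M(P) > 1.1883`). -/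
theorem lehmer_gap_census_listed :
    ∀ l ∈ coresDeg10 ++ coresDeg12 ++ coresDeg14 ++ coresDeg16 ++ coresDeg18 ++ coresDeg20 ++ coresDeg22 ++ coresDeg24 ++
        coresDeg26, l ≠ c10_01 → l ≠ c20_36 → l ≠ c20_37 →
      intMahlerMeasure lehmerPoly + 1 / 100 < intMahlerMeasure (ofCoeffs l) := by
  have hL := lehmer_measure_add_lt_gap
  intro l hl h01 h36 h37
  simp only [List.mem_append] at hl
  rcases hl with (((((((h | h) | h) | h) | h) | h) | h) | h) | h
  · exact lt_trans hL (census_le18_gap l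
      (by simp only [List.mem_append]; exact Or.inl (Or.inl (Or.inl (Or.inl h)))) h01)
  · exact lt_trans hL (census_le18_gap l
      (by simp only [List.mem_append]; exact Or.inl (Or.inl (Or.inl (Or.inr h)))) h01)
  · exact lt_trans hL (census_le18_gap l
      (by simp only [List.mem_append]; exact Or.inl (Or.inl (Or.inr h))) h01)
  · exact lt_trans hL (census_le18_gap l (by simp only [List.mem_append]; exact Or.inl (Or.inr h)) h01)
  · exact lt_trans hL (census_le18_gap l (by simp only [List.mem_append]; exact Or.inr h) h01)
  · exact lt_trans hL (coresDeg20_gap l h h36 h37)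
  · exact lt_trans hL (coresDeg22_gap l h)
  · exact lt_trans hL (coresDeg24_gap l h)
  · exact lt_trans hL (coresDeg26_gap l h)

/-- **Every listed height-1 polynomial of degree `46`/`48` has `M(P) > M(ℓ) + 1/20`.** -/
theorem lehmer_gap_height1_listed :
    ∀ l ∈ h1Deg46List ++ h1Deg48List,
      intMahlerMeasure lehmerPoly + 1 / 20 < intMahlerMeasure (ofCoeffs l) := by
  intro l hl
  rcases List.mem_append.mp hl with h | h
  exacts [h1Deg46_above_lehmer l h, h1Deg48_above_lehmer l h]

end Summit.Ventures.DiscreteObjects.Mahler
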